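import Summits.QuantumFields.YangMills.Theorems.UnitScaleTiltProp7FlatMemberLocalGradient
import Summits.QuantumFields.YangMills.Theorems.UnitScaleTiltProp7FlatInteriorGradientSourced
import HarnessLib

/-!
# (G1-0′) FILE D — the local η-scale gradient estimate for the flat massive equation WITH A REMAINDER, `(Δ^η_1 + 1)u = D*_1 g + r`, at the T³ member

Cell ym3-torus, crux `stmt-QuantumFields-19200` (`MinimiserStabilityRegPr`), post-S45 face (L3′b)-GRAD, the REMAINDER SLOT of (G1-3) (px12 g15 05:33:38Z LOCATE
NOTE option (i); ★p1 g25's cut).  Width seat `ym-ust-19200-w5` g14.  THEOREMS ONLY (0 `def`, 0 `sorry`, default heartbeats); `--supports stmt-QuantumFields-19200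
--as helper`; count-neutral.

WHAT.  ✓p761993 `Prop7FlatMemberLocalGradient.exists_localGradient_flat_member` (= lit ✓`B9Eq344LocalGradientFlat` read at the member) bounds the η-gradient
`ℓ‖u(x+e_μ) − u(x)‖` of a solution of `(Δ^η_1 + 1)u = D*_1 f` by `Cg(M_u + H_f)` — divergence-form data ONLY.  The covariant-to-flat comparison ✓p762644
`Prop7TwoBackgroundGradientComparison.two_background_gradient_comparison` (1) delivers `(Δ^η_1 + 1)u = D*_1 g + r` WITH an `L^∞` remainder `r`.  This file is the
sourced edition, on the ℤ^d brick ✓(G1-0′)-C `Prop7FlatInteriorGradientSourced.exists_interior_gradient_const_sourced` (superposition; no new Campanato iteration):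
* §1 ★ `gradient_flat_core_sourced` — plain functions on a torus `TSite d P` (`d ≥ 1`, `K ≥ 3`): `K²Σ_ν(2U − U₋ − U₊) + U = K·∂*F + R` everywhere, `‖U‖ ≤ M_u`,
  `‖R‖ ≤ M_r` on the `tdist`-ball of radius `4K` about `x`, `‖F(y′,μ) − F(y,μ)‖ ≤ H_f√(tdist∕K)` there ⟹ `K‖U(x+e_μ) − U(x)‖ ≤ C_d(M_u + H_f + M_r)` (lit
  ✓`gradient_flat_core`'s road VERBATIM — lift by ✓`exists_covering`, scalarise along a unit vector by ✓`norm_le_of_re_inner_le` — with the source `K⁻²·re⟪e, R∘π⟫`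
  of size `M_r∕K²`, priced `K·(M_r∕K²) = M_r∕K` by FILE C);
* §2 `localGradient_flat_P_sourced` — the `SiteL2K` currency on a general torus, any scale `K ≥ 1` (lit ✓`localGradient_flat_P` + `r`);
* §3 ★★ `exists_localGradient_flat_member_sourced` — AT THE T³ MEMBER (`F n K c₀`, `ℓ = L^{K−n}`, fibre `W₂`, ✓p761993's `covLapSite_one_eq`∕`DstarL2_one_eq`):
  `covLapSite F n K c₀ 1 u + ((1:ℝ):ℂ)•u = DstarL2 F n K c₀ 1 g + r`, `‖u‖ ≤ M_u` and `‖r‖ ≤ M_r` on the `tdist`-ball of radius `4ℓ` about `x`, `g` η-`½`-Hölder `H_g` there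
  ⟹ `ℓ·‖u(shift μ x) − u(x)‖ ≤ Cg·(M_u + H_g + M_r)` — the equation shape is ✓p762644's conclusion (1) with `g := f − (D_V − D_1)u`, `r := (D*_V − D*_1)(f − D_Vu) + (u − q)`;
  its rows (2)–(4) are `M_g`, `H_g`, `M_r`; `M_r` carries the gradient letter `G` only with the `O(ε₀)` factor `6√2·ℓδ`, so ✓`gradient_absorption` closes (G1-3)'s
  gradient row once `G` is read as a sup over centres (data on the `4ℓ`-enlarged ball).
HONEST.  [folklore] bookkeeping; nothing of (G1-3)'s knit, (★) at the member, the ten print rows, `hT`, `hGF`, EX or 19200 is proved here; rung R3 = SU(2) YM₃ on T³ —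
NOT d = 4, NOT infinite volume, NOT a mass gap, NOT Clay.
-/

noncomputable section

set_option autoImplicit false

open scoped InnerProductSpace ComplexConjugate BigOperators

namespace Summit.QuantumFields.YangMills.Theorems.Prop7FlatMemberLocalGradientSourced

open Literature.MathematicalPhysics.QuantumFieldTheory.Balaban1983to89
open Literature.MathematicalPhysics.QuantumFieldTheory.Balaban1983to89.T3ContinuumYM3Torus
open B4Sect5Torus (TSite tdist tdist_nonneg tdist_symm)
open B9SectCLatticeCarrier (Bond bpos shift unshift tdist_shift_le)
open B9Eq311L2Pairing (WL2)
open B11Eq103H1Complex (SiteL2K BondL2K covDivL2K covLaplaceSiteK equiv_covDivL2K)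
open B9Eq33CovDerivVector (covDiv_apply)
open B9Eq323KatoDomination (equiv_covLaplaceSiteK_eq_sum)
open B4Eq19LatticeOperators (Zd unitVec box mem_box lop dvg fdiff fdiff_apply)
open B9Eq343LocalHolderFlat (exists_covering norm_le_of_re_inner_le)
open T3SectALandauChart (eta eta_pos)
open Summit.QuantumFields.YangMills.Theorems.Prop7SectET3Transport (periodsT3)
open Summit.QuantumFields.YangMills.Theorems.Prop7SectET3HilbertLetters (W₂ DstarL2 covLapSite)
open Summit.QuantumFields.YangMills.Theorems.Prop7FlatMemberLocalGradient (covLapSite_one_eq DstarL2_one_eq one_le_ell ell_cast)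
open Summit.QuantumFields.YangMills.Theorems.Prop7FlatInteriorGradientSourced (exists_interior_gradient_const_sourced)

variable {d : ℕ}

/-! ## §1 ★ The core estimate with a source, for plain functions on a torus -/

/-- ★ **THE LOCAL GRADIENT ESTIMATE FOR THE FLAT MASSIVE LATTICE EQUATION WITH HÖLDER DIVERGENCE-FORM DATA AND A BOUNDED SOURCE ON A TORUS** (plain functions;
`d ≥ 1`; scale `K ≥ 3`): there is `C_d ≥ 0` such that for all periods `P`, all `U R : TSite d P → W`, `F : Bond d P → W` with
`Σ_ν K²·((U y − U(y−e_ν)) + (U y − U(y+e_ν))) + U y = K·Σ_ν (F(y−e_ν,ν) − F(y,ν)) + R y` at every site, `‖U‖ ≤ M_u` and `‖R‖ ≤ M_r` on the `tdist`-ball of radius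
`4K` about `x`, and `‖F(y′,μ) − F(y,μ)‖ ≤ H_f √(tdist(y,y′)∕K)` whenever `tdist(x,y), tdist(x,y′) ≤ 4K`: for every `μ`, `K·‖U(x+e_μ) − U(x)‖ ≤ C_d (M_u + H_f + M_r)`
(lift to `ℤ^d` by ✓`exists_covering`, scalarise, ✓`exists_interior_gradient_const_sourced` with data `K⁻¹·re⟪e, F∘π⟫` of modulus `H_f∕K` and source `K⁻²·re⟪e, R∘π⟫`
of size `M_r∕K²`). [folklore] [cite: Balaban1985BackgroundPropagators, Thm 3.1 (3.44) p.398; Balaban1984PropagatorsII, (1.9) p.226] -/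
theorem gradient_flat_core_sourced (hd : 1 ≤ d) {W : Type*} [NormedAddCommGroup W] [InnerProductSpace ℂ W] : ∃ C : ℝ, 0 ≤ C ∧
    ∀ (P : Fin d → ℕ) [∀ i, NeZero (P i)] (K : ℕ), 3 ≤ K → ∀ (U : TSite d P → W) (F : Bond d P → W) (R : TSite d P → W) (x : TSite d P) (Mu Hf Mr : ℝ),
      0 ≤ Mu → 0 ≤ Hf → 0 ≤ Mr →
      (∀ y, ∑ ν, ((K : ℝ) ^ 2) • ((U y - U (unshift ν y)) + (U y - U (shift ν y))) + (1 : ℝ) • U y = (K : ℝ) • ∑ ν, (F (unshift ν y, ν) - F (y, ν)) + R y) →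
      (∀ y, tdist P x y ≤ 4 * K → ‖U y‖ ≤ Mu) →
      (∀ (y y' : TSite d P) (μ : Fin d), tdist P x y ≤ 4 * K → tdist P x y' ≤ 4 * K → ‖F (y', μ) - F (y, μ)‖ ≤ Hf * Real.sqrt (tdist P y y' / K)) →
      (∀ y, tdist P x y ≤ 4 * K → ‖R y‖ ≤ Mr) →
      ∀ μ : Fin d, (K : ℝ) * ‖U (shift μ x) - U x‖ ≤ C * (Mu + Hf + Mr) := by
  classical
  obtain ⟨C, hC0, hC⟩ := exists_interior_gradient_const_sourced d hd
  refine ⟨C, hC0, ?_⟩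
  intro P _ K hK U F R x Mu Hf Mr hMu hHf hMr hU hbu hbf hbr μ
  have hP : ∀ i, 1 ≤ P i := fun i => Nat.one_le_iff_ne_zero.2 (NeZero.ne (P i))
  have hK0 : (0 : ℝ) < K := by exact_mod_cast (show 0 < K by omega)
  obtain ⟨π, hπadd, hπsub, hπlip, hπlift⟩ := exists_covering P
  obtain ⟨a, ha, -⟩ := hπlift 0 x
  -- scalarise along a unit vector `e`
  have hgoal : ‖U (shift μ x) - U x‖ ≤ C * (Mu + Hf + Mr) / K := by
    apply norm_le_of_re_inner_le
    intro e he
    set φ : W →L[ℝ] ℝ := Complex.reCLM.comp ((innerSL ℂ e).restrictScalars ℝ) with hφdef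
    have hφ : ∀ v : W, φ v = RCLike.re ⟪e, v⟫_ℂ := fun v => rfl
    have hφle : ∀ v : W, |φ v| ≤ ‖v‖ := fun v => by
      rw [hφ]
      calc |RCLike.re ⟪e, v⟫_ℂ| ≤ ‖⟪e, v⟫_ℂ‖ := RCLike.abs_re_le_norm _
        _ ≤ ‖e‖ * ‖v‖ := norm_inner_le_norm _ _
        _ ≤ 1 * ‖v‖ := mul_le_mul_of_nonneg_right he (norm_nonneg _)
        _ = ‖v‖ := one_mul _
    set uR : Zd d → ℝ := fun y => φ (U (π y)) with huR
    set gR : Zd d → Fin d → ℝ := fun y μ => (K : ℝ)⁻¹ * φ (F (π y, μ)) with hgR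
    set fR : Zd d → ℝ := fun y => 1 / (K : ℝ) ^ 2 * φ (R (π y)) with hfR
    -- the lattice equation `(−Δ + K⁻²) uR = ∂* gR + fR`
    have hEq : ∀ y ∈ box a (4 * (K : ℤ)), lop (1 / (K : ℝ) ^ 2) uR y = dvg gR y + fR y := by
      intro y _
      have h1 := congr_arg φ (hU (π y))
      simp only [map_add, map_sum, map_smul, map_sub, smul_eq_mul] at h1
      rw [← Finset.mul_sum] at h1
      rw [B4Eq19LatticeOperators.lop_apply, B4Eq19LatticeOperators.dvg_apply]
      simp only [huR, hgR, hfR, hπadd, hπsub]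
      have hA : ∑ ν, (2 * φ (U (π y)) - φ (U (shift ν (π y))) - φ (U (unshift ν (π y)))) =
          ∑ ν, (φ (U (π y)) - φ (U (unshift ν (π y))) + (φ (U (π y)) - φ (U (shift ν (π y))))) :=
        Finset.sum_congr rfl fun ν _ => by ring
      have hD : ∑ ν, ((K : ℝ)⁻¹ * φ (F (unshift ν (π y), ν)) - (K : ℝ)⁻¹ * φ (F (π y, ν))) =
          (K : ℝ)⁻¹ * ∑ ν, (φ (F (unshift ν (π y), ν)) - φ (F (π y, ν))) := by
        rw [Finset.mul_sum]; exact Finset.sum_congr rfl fun _ _ => by ring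
      rw [hA, hD]
      have hK2 : (K : ℝ) ^ 2 ≠ 0 := by positivity
      have hKne : (K : ℝ) ≠ 0 := hK0.ne'
      field_simp
      linear_combination h1
    -- the bounds on `Q_{4K}(a)`
    have hdist : ∀ y ∈ box a (4 * (K : ℤ)), tdist P x (π y) ≤ 4 * K := by
      intro y hy
      rw [← ha]
      have := hπlip a y (4 * (K : ℤ)) (by positivity) hy
      push_cast at this; exact this
    have hu' : ∀ y ∈ box a (4 * (K : ℤ)), |uR y| ≤ Mu := fun y hy => (hφle _).trans (hbu _ (hdist y hy))
    have hg' : ∀ (s : ℕ) (y y' : Zd d), y ∈ box a (4 * (K : ℤ)) → y' ∈ box a (4 * (K : ℤ)) → y' ∈ box y s →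
        ∀ ν, |gR y' ν - gR y ν| ≤ Hf / K * Real.sqrt (s / K) := by
      intro s y y' hy hy' hyy' ν
      rw [hgR]; dsimp only
      rw [← mul_sub, abs_mul, abs_of_pos (inv_pos.2 hK0), ← map_sub]
      have h1 : |φ (F (π y', ν) - F (π y, ν))| ≤ Hf * Real.sqrt (tdist P (π y) (π y') / K) :=
        (hφle _).trans (hbf (π y) (π y') ν (hdist y hy) (hdist y' hy'))
      have h2 : Real.sqrt (tdist P (π y) (π y') / K) ≤ Real.sqrt (s / K) := by
        apply Real.sqrt_le_sqrt
        exact div_le_div_of_nonneg_right (hπlip y y' s (by positivity) hyy') hK0.le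
      calc (K : ℝ)⁻¹ * |φ (F (π y', ν) - F (π y, ν))| ≤ (K : ℝ)⁻¹ * (Hf * Real.sqrt (s / K)) :=
            mul_le_mul_of_nonneg_left (h1.trans (mul_le_mul_of_nonneg_left h2 hHf)) (inv_pos.2 hK0).le
        _ = Hf / K * Real.sqrt (s / K) := by rw [div_eq_mul_inv]; ring
    have hf' : ∀ y ∈ box a (4 * (K : ℤ)), |fR y| ≤ Mr / (K : ℝ) ^ 2 := by
      intro y hy
      rw [hfR]; dsimp only
      rw [abs_mul, abs_of_pos (by positivity : (0 : ℝ) < 1 / (K : ℝ) ^ 2)]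
      have h1 : |φ (R (π y))| ≤ Mr := (hφle _).trans (hbr _ (hdist y hy))
      calc 1 / (K : ℝ) ^ 2 * |φ (R (π y))| ≤ 1 / (K : ℝ) ^ 2 * Mr := mul_le_mul_of_nonneg_left h1 (by positivity)
        _ = Mr / (K : ℝ) ^ 2 := by ring
    have hmain := (hC K hK uR gR fR a Mu (Hf / K) (Mr / (K : ℝ) ^ 2) hMu (by positivity) (by positivity) hEq hu' hg' hf' μ).1
    have e1 : C * (Mu / K + Hf / K + K * (Mr / (K : ℝ) ^ 2)) = C * (Mu + Hf + Mr) / K := by field_simp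
    rw [e1] at hmain
    -- `fdiff μ uR a = re⟪e, U(shift μ x) − U x⟫`
    have e2 : fdiff μ uR a = RCLike.re ⟪e, U (shift μ x) - U x⟫_ℂ := by
      rw [fdiff_apply, huR]; dsimp only; rw [hπadd, ha, ← map_sub, hφ]
    rw [← e2]
    exact (le_abs_self _).trans hmain
  rw [le_div_iff₀ hK0] at hgoal
  linarith

/-! ## §2 The `SiteL2K` currency on a general torus -/

/-- **The local gradient estimate with a remainder on a general torus `TSite d P`, in the `SiteL2K` currency**: from the core constant `C` (hypothesis `hC`, the
conclusion of ✓`gradient_flat_core_sourced`), for every scale `K ≥ 1` (`t = K`), every solution of `(Δ^t_1 + 1)u = D^{t*}_1 f + r` in `SiteL2K`, a local sup bound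
`M_u` on `u`, a local `½`-Hölder modulus `H_f` of `f` and a local sup bound `M_r` on `r` on the `tdist`-ball of radius `4K` about `x`:
`K·‖u(x+e_μ) − u(x)‖ ≤ (C + 4)(M_u + H_f + M_r)` (`K ≥ 3`: the core; `K ≤ 2`: the trivial bound `4M_u`). [folklore]
[cite: Balaban1985BackgroundPropagators, Thm 3.1 (3.44) p.398; Balaban1984PropagatorsII, (1.9) p.226] -/
theorem localGradient_flat_P_sourced {W : Type*} [NormedAddCommGroup W] [InnerProductSpace ℂ W] {C : ℝ} (hC0 : 0 ≤ C)
    (hC : ∀ (P : Fin d → ℕ) [∀ i, NeZero (P i)] (K : ℕ), 3 ≤ K → ∀ (U : TSite d P → W) (F : Bond d P → W) (R : TSite d P → W) (x : TSite d P) (Mu Hf Mr : ℝ),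
      0 ≤ Mu → 0 ≤ Hf → 0 ≤ Mr →
      (∀ y, ∑ ν, ((K : ℝ) ^ 2) • ((U y - U (unshift ν y)) + (U y - U (shift ν y))) + (1 : ℝ) • U y = (K : ℝ) • ∑ ν, (F (unshift ν y, ν) - F (y, ν)) + R y) →
      (∀ y, tdist P x y ≤ 4 * K → ‖U y‖ ≤ Mu) →
      (∀ (y y' : TSite d P) (μ : Fin d), tdist P x y ≤ 4 * K → tdist P x y' ≤ 4 * K → ‖F (y', μ) - F (y, μ)‖ ≤ Hf * Real.sqrt (tdist P y y' / K)) →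
      (∀ y, tdist P x y ≤ 4 * K → ‖R y‖ ≤ Mr) →
      ∀ μ : Fin d, (K : ℝ) * ‖U (shift μ x) - U x‖ ≤ C * (Mu + Hf + Mr))
    (P : Fin d → ℕ) [∀ i, NeZero (P i)] {K : ℕ} (hK1 : 1 ≤ K) {t : ℝ} (ht : t = K) {c₀ : ℝ} [Fact (0 < c₀)]
    (u r : SiteL2K ℂ d P c₀ W) (f : BondL2K ℂ d P c₀ W) (x : TSite d P) {Mu Hf Mr : ℝ} (hMu : 0 ≤ Mu) (hHf : 0 ≤ Hf) (hMr : 0 ≤ Mr)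
    (hu : covLaplaceSiteK ((t : ℝ) : ℂ) (fun _ : Bond d P => (LinearMap.id : W →ₗ[ℂ] W)) (fun _ => LinearMap.id) u + ((1 : ℝ) : ℂ) • u =
      covDivL2K ℂ c₀ ((t : ℝ) : ℂ) (fun _ : Bond d P => (LinearMap.id : W →ₗ[ℂ] W)) f + r)
    (hbu : ∀ y, tdist P x y ≤ 4 * (K : ℝ) → ‖WL2.equiv ℂ (fun _ : TSite d P => c₀) W u y‖ ≤ Mu)
    (hbf : ∀ (y y' : TSite d P) (μ : Fin d), tdist P x y ≤ 4 * (K : ℝ) → tdist P x y' ≤ 4 * (K : ℝ) →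
      ‖WL2.equiv ℂ (fun _ : Bond d P => c₀) W f (y', μ) - WL2.equiv ℂ (fun _ : Bond d P => c₀) W f (y, μ)‖ ≤ Hf * (tdist P y y' / (K : ℝ)) ^ ((1 : ℝ) / 2))
    (hbr : ∀ y, tdist P x y ≤ 4 * (K : ℝ) → ‖WL2.equiv ℂ (fun _ : TSite d P => c₀) W r y‖ ≤ Mr)
    (μ : Fin d) :
    (K : ℝ) * ‖WL2.equiv ℂ (fun _ : TSite d P => c₀) W u (shift μ x) - WL2.equiv ℂ (fun _ : TSite d P => c₀) W u x‖ ≤ (C + 4) * (Mu + Hf + Mr) := by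
  classical
  have hP : ∀ i, 1 ≤ P i := fun i => Nat.one_le_iff_ne_zero.2 (NeZero.ne (P i))
  have hK0 : (0 : ℝ) < K := by exact_mod_cast hK1
  -- the pointwise equation with real scalars `K²`, `1`, `K`
  have hpt : ∀ y : TSite d P, ∑ ν, ((K : ℝ) ^ 2) • ((WL2.equiv ℂ (fun _ : TSite d P => c₀) W u y - WL2.equiv ℂ (fun _ : TSite d P => c₀) W u (unshift ν y)) +
        (WL2.equiv ℂ (fun _ : TSite d P => c₀) W u y - WL2.equiv ℂ (fun _ : TSite d P => c₀) W u (shift ν y))) +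
        (1 : ℝ) • WL2.equiv ℂ (fun _ : TSite d P => c₀) W u y =
      (K : ℝ) • ∑ ν, (WL2.equiv ℂ (fun _ : Bond d P => c₀) W f (unshift ν y, ν) - WL2.equiv ℂ (fun _ : Bond d P => c₀) W f (y, ν))
        + WL2.equiv ℂ (fun _ : TSite d P => c₀) W r y := by
    intro y
    have e := congr_arg (fun g => WL2.equiv ℂ _ W g y) hu
    simp only [WL2.equiv_add, WL2.equiv_smul, Pi.add_apply, Pi.smul_apply] at e
    have hs := equiv_covLaplaceSiteK_eq_sum (𝕜 := ℂ) (c₀ := c₀) t (fun _ : Bond d P => (LinearMap.id : W →ₗ[ℂ] W)) (fun _ => LinearMap.id)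
      (fun b w => rfl) u y
    rw [RCLike.ofReal_eq_complex_ofReal] at hs
    rw [hs, equiv_covDivL2K, covDiv_apply] at e
    simp only [LinearMap.id_coe, id_eq, Complex.coe_smul] at e
    rw [ht] at e
    exact e
  -- the Hölder hypothesis with `Real.sqrt`
  have hbf' : ∀ (y y' : TSite d P) (μ : Fin d), tdist P x y ≤ 4 * (K : ℝ) → tdist P x y' ≤ 4 * (K : ℝ) →
      ‖WL2.equiv ℂ (fun _ : Bond d P => c₀) W f (y', μ) - WL2.equiv ℂ (fun _ : Bond d P => c₀) W f (y, μ)‖ ≤ Hf * Real.sqrt (tdist P y y' / K) := by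
    intro y y' ν h1 h2
    rw [Real.sqrt_eq_rpow]; exact hbf y y' ν h1 h2
  have hRHS0 : 0 ≤ (C + 4) * (Mu + Hf + Mr) := by positivity
  by_cases hK3 : 3 ≤ K
  · -- the main case
    have hmain := hC P K hK3 _ _ (fun y => WL2.equiv ℂ (fun _ : TSite d P => c₀) W r y) x Mu Hf Mr hMu hHf hMr hpt hbu hbf' hbr μ
    refine hmain.trans ?_
    nlinarith
  · -- small scale `K ≤ 2`: the trivial bound `4 M_u`
    have hK2 : (K : ℝ) ≤ 2 := by exact_mod_cast (show K ≤ 2 by omega)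
    have hx : tdist P x x ≤ 4 * K := by rw [B4Sect5Torus.tdist_self]; positivity
    have hK1R : (1 : ℝ) ≤ K := by exact_mod_cast hK1
    have hx' : tdist P x (shift μ x) ≤ 4 * K := (tdist_shift_le hP μ x).trans (by linarith)
    have h1 : ‖WL2.equiv ℂ (fun _ : TSite d P => c₀) W u (shift μ x) - WL2.equiv ℂ (fun _ : TSite d P => c₀) W u x‖ ≤ 2 * Mu := by
      calc ‖WL2.equiv ℂ (fun _ : TSite d P => c₀) W u (shift μ x) - WL2.equiv ℂ (fun _ : TSite d P => c₀) W u x‖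
          ≤ ‖WL2.equiv ℂ (fun _ : TSite d P => c₀) W u (shift μ x)‖ + ‖WL2.equiv ℂ (fun _ : TSite d P => c₀) W u x‖ := norm_sub_le _ _
        _ ≤ Mu + Mu := add_le_add (hbu _ hx') (hbu x hx)
        _ = 2 * Mu := by ring
    have h0 : 0 ≤ ‖WL2.equiv ℂ (fun _ : TSite d P => c₀) W u (shift μ x) - WL2.equiv ℂ (fun _ : TSite d P => c₀) W u x‖ := norm_nonneg _
    calc (K : ℝ) * ‖WL2.equiv ℂ (fun _ : TSite d P => c₀) W u (shift μ x) - WL2.equiv ℂ (fun _ : TSite d P => c₀) W u x‖ ≤ 2 * (2 * Mu) :=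
          mul_le_mul hK2 h1 h0 (by norm_num)
      _ ≤ (C + 4) * (Mu + Hf + Mr) := by nlinarith

/-! ## §3 ★★ The local gradient estimate with a remainder at the flat T³ member -/

/-- ★★ **THE LOCAL η-SCALE GRADIENT ESTIMATE WITH A REMAINDER AT THE FLAT T³ MEMBER.**  There is `Cg ≥ 0` (dimension `3` only) such that for every `F, n, K, c₀`, every
`u g r` with `covLapSite F n K c₀ 1 u + u = DstarL2 F n K c₀ 1 g + r` — the shape of ✓p762644 `two_background_gradient_comparison` (1), `g := f − (D_V − D_1)u`,
`r := (D*_V − D*_1)(f − D_Vu) + (u − q)` — and every centre `x`: if `‖u(y)‖ ≤ M_u` and `‖r(y)‖ ≤ M_r` on the `tdist`-ball of radius `4ℓ` about `x` (`ℓ = L^{K−n}`) and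
`‖g(y′,μ) − g(y,μ)‖ ≤ H_g·(tdist(y,y′)∕ℓ)^{½}` for bond positions in that ball, then for every direction `μ`:
`ℓ·‖u(shift μ x) − u(x)‖ ≤ Cg·(M_u + H_g + M_r)` — UNIFORMLY IN `K − n` (§2 at `P := periodsT3 F K`, `K := ℓ`, through ✓`covLapSite_one_eq`, ✓`DstarL2_one_eq`).
[cite: Balaban1985BackgroundPropagators, Thm 3.1 (3.44) p.398; Balaban1984PropagatorsII, (1.9) p.226] -/
theorem exists_localGradient_flat_member_sourced : ∃ Cg : ℝ, 0 ≤ Cg ∧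
    ∀ (F : T3Family) (n K : ℕ) (c₀ : ℝ) [Fact (0 < c₀)]
      (u r : SiteL2K ℂ 3 (periodsT3 F K) c₀ W₂) (g : BondL2K ℂ 3 (periodsT3 F K) c₀ W₂) (x : TSite 3 (periodsT3 F K)) (Mu Hg Mr : ℝ), 0 ≤ Mu → 0 ≤ Hg → 0 ≤ Mr →
      covLapSite F n K c₀ 1 u + ((1 : ℝ) : ℂ) • u = DstarL2 F n K c₀ 1 g + r →
      (∀ y, tdist (periodsT3 F K) x y ≤ 4 * ((F.L : ℝ) ^ (K - n)) → ‖WL2.equiv ℂ (fun _ : TSite 3 (periodsT3 F K) => c₀) W₂ u y‖ ≤ Mu) →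
      (∀ (y y' : TSite 3 (periodsT3 F K)) (μ : Fin 3), tdist (periodsT3 F K) x y ≤ 4 * ((F.L : ℝ) ^ (K - n)) → tdist (periodsT3 F K) x y' ≤ 4 * ((F.L : ℝ) ^ (K - n)) →
        ‖WL2.equiv ℂ (fun _ : Bond 3 (periodsT3 F K) => c₀) W₂ g (y', μ) - WL2.equiv ℂ (fun _ : Bond 3 (periodsT3 F K) => c₀) W₂ g (y, μ)‖ ≤
          Hg * (tdist (periodsT3 F K) y y' / ((F.L : ℝ) ^ (K - n))) ^ ((1 : ℝ) / 2)) →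
      (∀ y, tdist (periodsT3 F K) x y ≤ 4 * ((F.L : ℝ) ^ (K - n)) → ‖WL2.equiv ℂ (fun _ : TSite 3 (periodsT3 F K) => c₀) W₂ r y‖ ≤ Mr) →
      ∀ μ : Fin 3, (F.L : ℝ) ^ (K - n) * ‖WL2.equiv ℂ (fun _ : TSite 3 (periodsT3 F K) => c₀) W₂ u (shift μ x) - WL2.equiv ℂ (fun _ : TSite 3 (periodsT3 F K) => c₀) W₂ u x‖
        ≤ Cg * (Mu + Hg + Mr) := by
  obtain ⟨C, hC0, hC⟩ := gradient_flat_core_sourced (d := 3) (by norm_num) (W := W₂)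
  refine ⟨C + 4, by linarith, ?_⟩
  intro F n K c₀ _ u r g x Mu Hg Mr hMu hHg hMr hu hbu hbg hbr μ
  have hell := ell_cast F n K
  have h := localGradient_flat_P_sourced (d := 3) hC0 hC (periodsT3 F K) (one_le_ell F n K) (t := ((F.L ^ (K - n) : ℕ) : ℝ)) rfl u r g x hMu hHg hMr
    (by rw [← covLapSite_one_eq F n K c₀, ← DstarL2_one_eq F n K c₀]; exact hu)
    (fun y hy => hbu y (by rwa [hell] at hy)) (fun y y' ν hy hy' => by
      have := hbg y y' ν (by rwa [hell] at hy) (by rwa [hell] at hy')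
      rwa [hell]) (fun y hy => hbr y (by rwa [hell] at hy)) μ
  rwa [hell] at h

end Summit.QuantumFields.YangMills.Theorems.Prop7FlatMemberLocalGradientSourced

end
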